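import Summits.ResolutionOfSingularities.ResolutionOfSingularities.Theorems.WeightedInvariantOrbitChartParameters
import Summits.ResolutionOfSingularities.ResolutionOfSingularities.Theorems.WeightedInvariantOrbitChartCutsOrbit
import Summits.ResolutionOfSingularities.ResolutionOfSingularities.Theorems.WeightedInvariantELadderOneStageInv
import Literature.AlgebraicGeometry.Resolution.SmoothStalksRegular
import HarnessLib

/-!
# The orbit-wise centre of rung `e = 1` is a regular weighted centre

Route `ResolutionOfSingularities/WeightedInvariant`, door crux `HypersurfaceCentreConstruction`
(stmt-ResolutionOfSingularities-19897) — OURS, helper; e-ladder `e = 1`, registered stub `stub_e1_centre` of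
`res-L1-w43-stub-10` (cell res-hironaka, `D/res-D-pv-025/DOOR-ELADDER-PLAN.md` §7–§8, sub-lemma **L0-charts**,
assembly).

For a stage `S` satisfying the invariant `Inv'`, a maximal singular point `η`, and a regular system of parameters
`x = (x₀, x₁)` of `𝒪_{Y,η}` with weights `0 < w₁ ≤ w₀` (the Abramovich–Quek–Schober germ), the Rees algebra
`R_η = ReesAlgebraData.ofGermFiltration η (𝒥∙(x; w))` CONTRACTED from the germ filtration is a REGULAR WEIGHTED
CENTRE on all of `Y` (`Stage.isRegularWeightedCentre_ofGermFiltration`), GIVEN two inputs delivered by sibling files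
of the line and taken here as hypotheses:

* `(hhom)` on every unit chart `W` of the graded atlas through `η`, the contracted piece
  `Γ(Y, W) ∩ 𝒥_{w₀}(x)` is homogeneous (the `(hom)` lemma L3, res-type-047:
  `…OrbitCentreHomogeneous*`);
* `(hLT)` on such a chart, HOMOGENEOUS sections vanishing on `closure {η}` whose germs are independent in
  `𝔪_η/𝔪_η²` stay independent in `𝔪_y/𝔪_y²` at every `y ∈ W ∩ closure {η}` (L0-T, torus transfer along the
  graded-simple orbit).

Charts: off `closure {η}` the unit chart (all pieces are `(1)` there); at `y ∈ closure {η}`: a unit chart `W ∋ y`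
(`exists_isUnitChart`), homogeneous parameters `f₀, f₁ ∈ 𝔭_η` chosen at `η`
(`exists_homogeneous_orbitChartParameters`, using (I1), (I2w) and `(hhom)`), independent at `y` by `(hLT)`, hence
cutting out `closure {η}` on an affine `U ∋ y` (`exists_affineOpen_zero_subset_closure`), on which the contraction
IS the weighted chart of `f` (`germContractionIdeal_weightedMonomialIdeal_germ_eq`, file `…GermContractionChart`).

No named facts. AI-written; weaker than expert review.
-/

noncomputable section

set_option linter.dupNamespace false -- mandated namespace of this single-conjunct summit

namespace Summit.ResolutionOfSingularities.ResolutionOfSingularities.Theorems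

universe u

open CategoryTheory AlgebraicGeometry TopologicalSpace IsLocalRing Opposite
open Literature.AlgebraicGeometry.Resolution

/-! ## Two small tools -/

section Tools

variable {Y : Scheme.{u}}

/-- The chart lemma of `…GermContractionChart` for a germ filtration merely EQUAL to the weighted filtration of
the germs of the sections. [folklore] -/
theorem isWeightedChart_ofGermFiltration_of_eq (U : Y.affineOpens) {m : ℕ} (u : Fin m → Γ(Y, U))
    (w : Fin m → ℕ) {η : Y} (hηU : η ∈ (U : Y.Opens)) (hw : ∀ i, 0 < w i)
    (hvan : ∀ i, (Y.presheaf.germ (U : Y.Opens) η hηU).hom (u i) ∈ maximalIdeal (Y.presheaf.stalk η))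
    (hcl : ∀ (y : Y) (hy : y ∈ (U : Y.Opens)),
      (∀ i, (Y.presheaf.germ (U : Y.Opens) y hy).hom (u i) ∈ maximalIdeal (Y.presheaf.stalk y)) →
      y ∈ closure ({η} : Set Y))
    (hreg : ∀ (y : Y) (hy : y ∈ (U : Y.Opens)),
      (∀ i, (Y.presheaf.germ (U : Y.Opens) y hy).hom (u i) ∈ maximalIdeal (Y.presheaf.stalk y)) →
      IsRegularLocalRing (Y.presheaf.stalk y))
    (hli : ∀ (y : Y) (hy : y ∈ (U : Y.Opens))
      (h : ∀ i, (Y.presheaf.germ (U : Y.Opens) y hy).hom (u i) ∈ maximalIdeal (Y.presheaf.stalk y)),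
      LinearIndependent (ResidueField (Y.presheaf.stalk y))
        (fun i => (maximalIdeal (Y.presheaf.stalk y)).toCotangent ⟨_, h i⟩))
    (I : ℕ → Ideal (Y.presheaf.stalk η)) (h0 : I 0 = ⊤) (hmul : ∀ a b, I a * I b ≤ I (a + b))
    (hprim : ∀ n, ∃ N : ℕ, maximalIdeal (Y.presheaf.stalk η) ^ N ≤ I n)
    (hI : ∀ n, I n = weightedMonomialIdeal (fun i => (Y.presheaf.germ (U : Y.Opens) η hηU).hom (u i)) w n) :
    (ReesAlgebraData.ofGermFiltration η I h0 hmul hprim).IsWeightedChart U u w := by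
  obtain rfl : I = fun n => weightedMonomialIdeal (fun i => (Y.presheaf.germ (U : Y.Opens) η hηU).hom (u i)) w n :=
    funext hI
  exact isWeightedChart_ofGermFiltration U u w hηU hw hvan hcl hreg hli h0 hmul hprim

/-- **Off `η`, the contracted Rees algebra has the unit chart**: on an affine open missing `η` all its pieces are
the unit ideal, presented by the single unit parameter `1` of weight `1`. [folklore] -/
theorem isWeightedChart_ofGermFiltration_of_not_mem {η : Y} (I : ℕ → Ideal (Y.presheaf.stalk η))
    (h0 : I 0 = ⊤) (hmul : ∀ a b, I a * I b ≤ I (a + b))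
    (hprim : ∀ n, ∃ N : ℕ, maximalIdeal (Y.presheaf.stalk η) ^ N ≤ I n)
    (U : Y.affineOpens) (hηU : η ∉ (U : Y.Opens)) :
    (ReesAlgebraData.ofGermFiltration η I h0 hmul hprim).IsWeightedChart U (fun _ : Fin 1 => (1 : Γ(Y, U)))
      (fun _ => 1) := by
  refine ⟨fun _ => Nat.one_pos, fun n => ?_, ?_⟩
  · change germContractionIdeal η (I n) U = _
    rw [germContractionIdeal_of_not_mem η _ hηU, ReesAlgebraData.weightedMonomialIdeal_one]
  · intro y hy h
    exfalso
    have h1 := h 0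
    rw [map_one] at h1
    exact (maximalIdeal.isMaximal _).ne_top (Ideal.eq_top_of_isUnit_mem _ h1 isUnit_one)

end Tools

/-! ## The orbit-wise centre is a regular weighted centre -/

namespace ELadderOne.Stage

variable {k : Type} [Field k] (S : Stage k)

/-- **The orbit-wise centre of rung `e = 1` is a regular weighted centre.**  See the module docstring for the
two hypotheses `hhom` (L3) and `hLT` (L0-T). [folklore] -/
theorem isRegularWeightedCentre_ofGermFiltration (hInv : S.Inv') {η : S.Y} (hη : η ∈ S.maxSing)
    (x : Fin 2 → S.Y.presheaf.stalk η) (w : Fin 2 → ℕ) (hw1 : 0 < w 1) (hw : w 1 ≤ w 0)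
    (hx : Ideal.span (Set.range x) = maximalIdeal (S.Y.presheaf.stalk η))
    (h0 : weightedMonomialIdeal x w 0 = ⊤)
    (hmul : ∀ a b, weightedMonomialIdeal x w a * weightedMonomialIdeal x w b ≤ weightedMonomialIdeal x w (a + b))
    (hprim : ∀ n, ∃ N : ℕ, maximalIdeal (S.Y.presheaf.stalk η) ^ N ≤ weightedMonomialIdeal x w n)
    (hhom : ∀ (a : S.atlas.ι), S.IsUnitChart a → ∀ (hηa : η ∈ (S.atlas.W a : S.Y.Opens)),
      letI := S.atlas.gradedRing a
      (germContractionIdeal η (weightedMonomialIdeal x w (w 0)) (S.atlas.W a)).IsHomogeneous (S.atlas.piece a))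
    (hLT : ∀ (a : S.atlas.ι), S.IsUnitChart a → ∀ (hηa : η ∈ (S.atlas.W a : S.Y.Opens))
      (f : Fin 2 → Γ(S.Y, S.atlas.W a)) (d : Fin 2 → (Fin S.j → ℤ)),
      (∀ i, f i ∈ S.atlas.piece a (d i)) →
      (∀ i, f i ∈ ((S.atlas.W a).2.primeIdealOf ⟨η, hηa⟩).asIdeal) →
      (∀ (hfη : ∀ i, (S.Y.presheaf.germ (S.atlas.W a : S.Y.Opens) η hηa).hom (f i) ∈
          maximalIdeal (S.Y.presheaf.stalk η)),
        LinearIndependent (ResidueField (S.Y.presheaf.stalk η))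
          (fun i => (maximalIdeal (S.Y.presheaf.stalk η)).toCotangent ⟨_, hfη i⟩) →
        ∀ (y : S.Y) (hya : y ∈ (S.atlas.W a : S.Y.Opens)), y ∈ closure ({η} : Set S.Y) →
          ∀ (hfy : ∀ i, (S.Y.presheaf.germ (S.atlas.W a : S.Y.Opens) y hya).hom (f i) ∈
            maximalIdeal (S.Y.presheaf.stalk y)),
          LinearIndependent (ResidueField (S.Y.presheaf.stalk y))
            (fun i => (maximalIdeal (S.Y.presheaf.stalk y)).toCotangent ⟨_, hfy i⟩))) :
    (ReesAlgebraData.ofGermFiltration η (fun n => weightedMonomialIdeal x w n) h0 hmul hprim).IsRegularWeightedCentre := by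
  haveI : IsLocallyNoetherian S.Y := LocallyOfFiniteType.isLocallyNoetherian S.f
  have hwpos : ∀ i, 0 < w i := fun i => by fin_cases i <;> [exact hw1.trans_le hw; exact hw1]
  intro y
  by_cases hy : y ∈ closure ({η} : Set S.Y)
  swap
  · -- off the orbit closure: the unit chart on an affine neighbourhood missing `closure {η}`
    obtain ⟨U, hU, hyU, hUc⟩ := exists_isAffineOpen_mem_and_subset (X := S.Y) (x := y)
      (U := ⟨(closure ({η} : Set S.Y))ᶜ, isClosed_closure.isOpen_compl⟩) hy
    have hηU : η ∉ U := fun h => hUc h (subset_closure (Set.mem_singleton η))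
    exact ⟨⟨U, hU⟩, hyU, 1, _, _, isWeightedChart_ofGermFiltration_of_not_mem _ h0 hmul hprim ⟨U, hU⟩ hηU⟩
  -- on the orbit closure: a unit chart `W a ∋ y`
  obtain ⟨x', hx'⟩ := S.mem_range_of_mem_singImage (S.closure_subset_singImage hη.1 hy)
  obtain ⟨a, hya, hunit⟩ := S.exists_isUnitChart x'
  rw [hx'] at hya
  have hηa : η ∈ (S.atlas.W a : S.Y.Opens) := by
    obtain ⟨z, hz, hzη⟩ := mem_closure_iff.mp hy _ (S.atlas.W a : S.Y.Opens).isOpen hya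
    rw [Set.mem_singleton_iff] at hzη
    exact hzη ▸ hz
  letI := S.atlas.gradedRing a
  obtain ⟨hPhom, -⟩ := hInv.invOrbit a hunit η hη hηa
  haveI : IsRegularLocalRing (S.Y.presheaf.stalk η) := (hInv.invReg η hη).1
  have hdim := (hInv.invReg η hη).2
  -- homogeneous parameters chosen at `η`
  obtain ⟨f, d, hfd, hf𝔭, hfη, hspan, hliη, hfilt⟩ :=
    exists_homogeneous_orbitChartParameters (S.atlas.W a) (S.atlas.piece a) hηa hdim x w hw1 hw hx hPhom
      (hhom a hunit hηa)
  -- independence at `y`, and the neighbourhood `U ∋ y` on which `f` cuts out `closure {η}`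
  haveI : IsRegularLocalRing (S.Y.presheaf.stalk y) := isRegularLocalRing_stalk_of_smooth_of_field S.f y
  have hfy : ∀ i, (S.Y.presheaf.germ (S.atlas.W a : S.Y.Opens) y hya).hom (f i) ∈
      maximalIdeal (S.Y.presheaf.stalk y) := fun i =>
    (germ_mem_maximalIdeal_iff_mem_primeIdealOf (S.atlas.W a) hya (f i)).mpr
      (primeIdealOf_le_of_mem_closure (S.atlas.W a) hηa hya hy (hf𝔭 i))
  have hliy := hLT a hunit hηa f d hfd hf𝔭 hfη hliη y hya hy hfy
  have heq := span_germ_pair_eq_map_primeIdealOf (S.atlas.W a) hηa hya hy hdim f hf𝔭 hfy hliy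
  obtain ⟨U, hUW, hyU, hclU⟩ := exists_affineOpen_zero_subset_closure (S.atlas.W a) hηa hya f heq
  have hηU : η ∈ (U : S.Y.Opens) := by
    obtain ⟨z, hz, hzη⟩ := mem_closure_iff.mp hy _ (U : S.Y.Opens).isOpen hyU
    rw [Set.mem_singleton_iff] at hzη
    exact hzη ▸ hz
  -- germs of the restricted sections
  have hgerm : ∀ (z : S.Y) (hz : z ∈ (U : S.Y.Opens)) (i : Fin 2),
      (S.Y.presheaf.germ (U : S.Y.Opens) z hz).hom ((S.Y.presheaf.map (homOfLE hUW).op).hom (f i)) =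
        (S.Y.presheaf.germ (S.atlas.W a : S.Y.Opens) z (hUW hz)).hom (f i) := fun z hz i =>
    TopCat.Presheaf.germ_res_apply S.Y.presheaf (homOfLE hUW) z hz (f i)
  refine ⟨U, hyU, 2, fun i => (S.Y.presheaf.map (homOfLE hUW).op).hom (f i), w,
    isWeightedChart_ofGermFiltration_of_eq U _ w hηU hwpos ?_ hclU
      (fun z _ _ => isRegularLocalRing_stalk_of_smooth_of_field S.f z) ?_ _ h0 hmul hprim ?_⟩
  · -- `hvan`
    intro i
    rw [hgerm η hηU i]
    exact hfη i
  · -- `hli`: points of `V(f) ∩ U` lie in `closure {η}`, where `(hLT)` applies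
    intro z hz h
    have hzc : z ∈ closure ({η} : Set S.Y) := hclU z hz h
    have h' : ∀ i, (S.Y.presheaf.germ (S.atlas.W a : S.Y.Opens) z (hUW hz)).hom (f i) ∈
        maximalIdeal (S.Y.presheaf.stalk z) := fun i => hgerm z hz i ▸ h i
    have hliz := hLT a hunit hηa f d hfd hf𝔭 hfη hliη z (hUW hz) hzc h'
    have hfun : (fun i => (maximalIdeal (S.Y.presheaf.stalk z)).toCotangent
        ⟨(S.Y.presheaf.germ (U : S.Y.Opens) z hz).hom ((S.Y.presheaf.map (homOfLE hUW).op).hom (f i)), h i⟩) =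
        (fun i => (maximalIdeal (S.Y.presheaf.stalk z)).toCotangent
          ⟨(S.Y.presheaf.germ (S.atlas.W a : S.Y.Opens) z (hUW hz)).hom (f i), h' i⟩) := by
      funext i
      congr 1
      exact Subtype.ext (hgerm z hz i)
    rw [hfun]
    exact hliz
  · -- the filtrations agree
    intro n
    rw [← hfilt n]
    congr 1
    funext i
    exact (hgerm η hηU i).symm

end ELadderOne.Stage

end Summit.ResolutionOfSingularities.ResolutionOfSingularities.Theorems

end
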